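import Mathlib
import Summits.ResolutionOfSingularities.ResolutionOfSingularities.Theorems.WildQuotientsWildQuotientResolutionToricChartFaceIdeal
import Summits.ResolutionOfSingularities.ResolutionOfSingularities.Theorems.WildQuotientsWildQuotientResolutionQuarter1123Ideals
import Summits.ResolutionOfSingularities.ResolutionOfSingularities.Theorems.WildQuotientsWildQuotientResolutionQuarter1123Blowup

/-!
# The `μ₄` vertex piece of `Y(J₅)`: the one-shot product centre `J_T · (J_T² : J_A)` is `I_A^{(3)}`, and its blow-up is regular

(crux stmt-ResolutionOfSingularities-15640 `WildQuotients.WildQuotientResolution`, line `Sketch`,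
sector `|G| = p`; RUNG V5 brick B5/HP₀ of `L/w45c/CHAIN.md` — plan-1 RULING v8.4-B (β‴ «ONE-SHOT
PRODUCT CENTRE», 2026-08-27T12:31Z; lead-1 «β‴ OK» 12:54Z; design `L/w45c/HP0-ONESHOT-DESIGN.md`
§5 ring side): in the chart-0 ring model `R₀ = ToricChart.Ring k P quarterDatum` with
`J_T := faceIdeal {s,t,v}` (reduced singular axis, radical by `ToricChart.isRadical_faceIdeal`) and
`J_A := faceIdeal univ` (reduced vertex line), the consumer's regularity input
`hreg : IsRegular (affineBlowup (J_T * (J_T ^ 2).colon J_A))` is `Quarter1123.blowup_regular`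
(p530529) after the identity `J_T · (J_T² : J_A) = I_A^{(3)}` (`faceIdeal_mul_colon_eq`, from
`colon_axisSq_vertex` + `span_quarterGens_eq_mul` of `…Quarter1123Ideals`).
[OURS · L1 W4.5c] — NOT a statement of any manuscript; replaces the role of no printed item.
Prover res-L1-w45c-stub-4 (gen 4).)
-/

-- single-problem summit: the doubled namespace component `ResolutionOfSingularities` is forced
set_option linter.dupNamespace false

noncomputable section

namespace Summit.ResolutionOfSingularities.ResolutionOfSingularities.Theorems.WildQuotientResolution.Quarter1123

open ToricChart


section FaceIdeals

variable (k : Type) [Field k] (P : Type)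


/-- The pure powers of `quarterDatum` are positive. [OURS · L1 W4.5c] -/
theorem quarterDatum_pw_pos : ∀ s, 0 < quarterDatum.pw s := by decide

/-- Every mixed Hilbert monomial of `¼(1,1,2,3)` involves `s`, `t` or `v`. [OURS · L1 W4.5c] -/
theorem quarterDatum_mx_axis : ∀ j : Fin 9, ∃ i ∈ ({0, 1, 3} : Finset (Fin 4)), quarterDatum.mx j i ≠ 0 := by
  decide

/-- **`J_T = faceIdeal {s,t,v}` (the reduced singular axis) is prime.** [OURS · L1 W4.5c] -/
theorem isPrime_faceIdeal_axis : (faceIdeal k P quarterDatum {0, 1, 3}).IsPrime :=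
  isPrime_faceIdeal quarterDatum_pw_pos quarterDatum_mx_axis

/-- `J_T` is radical. [OURS · L1 W4.5c] -/
theorem isRadical_faceIdeal_axis : (faceIdeal k P quarterDatum {0, 1, 3}).IsRadical :=
  (isPrime_faceIdeal_axis k P).isRadical

/-- **`J_A = faceIdeal univ` (the reduced vertex line) is prime.** [OURS · L1 W4.5c] -/
theorem isPrime_faceIdeal_univ : (faceIdeal k P quarterDatum Finset.univ).IsPrime :=
  isPrime_faceIdeal quarterDatum_pw_pos fun j => by
    obtain ⟨i, _, hi⟩ := quarterDatum_mx_axis j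
    exact ⟨i, Finset.mem_univ i, hi⟩

/-- `J_A` is radical. [OURS · L1 W4.5c] -/
theorem isRadical_faceIdeal_univ : (faceIdeal k P quarterDatum Finset.univ).IsRadical :=
  (isPrime_faceIdeal_univ k P).isRadical

/-- The reduced singular-axis ideal as a face ideal: `faceIdeal {s,t,v} = (axisGens)`. [OURS · L1 W4.5c] -/
theorem faceIdeal_axis_eq :
    faceIdeal k P quarterDatum {0, 1, 3} = spanWords k P quarterDatum axisGens := by
  apply le_antisymm
  · rw [faceIdeal, Ideal.span_le]
    rintro x (⟨s, hs, rfl⟩ | ⟨j, rfl⟩)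
    · simp only [Finset.coe_insert, Finset.coe_singleton, Set.mem_insert_iff,
        Set.mem_singleton_iff] at hs
      rcases hs with rfl | rfl | rfl
      · exact Ideal.subset_span ⟨0, rfl⟩
      · exact Ideal.subset_span ⟨1, rfl⟩
      · exact Ideal.subset_span ⟨2, rfl⟩
    · refine Ideal.subset_span ⟨⟨3 + j.1, by omega⟩, ?_⟩
      fin_cases j <;> rfl
  · rw [spanWords, Ideal.span_le]
    rintro x ⟨l, rfl⟩
    apply Ideal.subset_span
    fin_cases l
    · exact Or.inl ⟨0, by simp, rfl⟩
    · exact Or.inl ⟨1, by simp, rfl⟩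
    · exact Or.inl ⟨3, by simp, rfl⟩
    · exact Or.inr ⟨0, rfl⟩
    · exact Or.inr ⟨1, rfl⟩
    · exact Or.inr ⟨2, rfl⟩
    · exact Or.inr ⟨3, rfl⟩
    · exact Or.inr ⟨4, rfl⟩
    · exact Or.inr ⟨5, rfl⟩
    · exact Or.inr ⟨6, rfl⟩
    · exact Or.inr ⟨7, rfl⟩
    · exact Or.inr ⟨8, rfl⟩

/-- The vertex-line ideal as a face ideal: `faceIdeal univ = (hilbertGens)`. [OURS · L1 W4.5c] -/
theorem faceIdeal_univ_eq :
    faceIdeal k P quarterDatum Finset.univ = spanWords k P quarterDatum hilbertGens := by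
  apply le_antisymm
  · rw [faceIdeal, Ideal.span_le]
    rintro x (⟨s, -, rfl⟩ | ⟨j, rfl⟩)
    · refine Ideal.subset_span ⟨⟨s.1, by omega⟩, ?_⟩
      fin_cases s <;> rfl
    · refine Ideal.subset_span ⟨⟨4 + j.1, by omega⟩, ?_⟩
      fin_cases j <;> rfl
  · rw [spanWords, Ideal.span_le]
    rintro x ⟨l, rfl⟩
    apply Ideal.subset_span
    fin_cases l
    · exact Or.inl ⟨0, by simp, rfl⟩
    · exact Or.inl ⟨1, by simp, rfl⟩
    · exact Or.inl ⟨2, by simp, rfl⟩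
    · exact Or.inl ⟨3, by simp, rfl⟩
    · exact Or.inr ⟨0, rfl⟩
    · exact Or.inr ⟨1, rfl⟩
    · exact Or.inr ⟨2, rfl⟩
    · exact Or.inr ⟨3, rfl⟩
    · exact Or.inr ⟨4, rfl⟩
    · exact Or.inr ⟨5, rfl⟩
    · exact Or.inr ⟨6, rfl⟩
    · exact Or.inr ⟨7, rfl⟩
    · exact Or.inr ⟨8, rfl⟩

/-- **The one-shot product centre of the `μ₄` piece is `I_A^{(3)}`**: with `J_T = faceIdeal {s,t,v}` (the
reduced singular axis) and `J_A = faceIdeal univ` (the reduced vertex line),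
`J_T · (J_T² : J_A) = (quarterGens)` — the 38-generator ideal of `…Quarter1123Defs`.
[OURS · L1 W4.5c] -/
theorem faceIdeal_mul_colon_eq :
    faceIdeal k P quarterDatum {0, 1, 3} *
        (faceIdeal k P quarterDatum {0, 1, 3} ^ 2).colon
          (faceIdeal k P quarterDatum Finset.univ : Set (ToricChart.Ring k P quarterDatum)) =
      Ideal.span (Set.range fun i : Fin 38 => wordElem k P quarterDatum (quarterGens i)) := by
  rw [faceIdeal_axis_eq, faceIdeal_univ_eq, colon_axisSq_vertex, ← span_quarterGens_eq_mul]
  rfl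

open AlgebraicGeometry CategoryTheory Literature.AlgebraicGeometry.Resolution in
/-- **RUNG V5 brick HP₀, ring side (β‴ ONE-SHOT PRODUCT CENTRE, plan-1 RULING v8.4-B): the
blow-up of the `μ₄` cone ring `¼(1,1,2,3) × 𝔸^P` along `J_T · (J_T² : J_A)` is regular, integral,
proper and birational** (= `Quarter1123.blowup_regular` after `faceIdeal_mul_colon_eq`).
[OURS · L1 W4.5c] -/
theorem blowup_regular_mulColon [Finite P] :
    Scheme.IsRegular (affineBlowup (faceIdeal k P quarterDatum {0, 1, 3} *
        (faceIdeal k P quarterDatum {0, 1, 3} ^ 2).colon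
          (faceIdeal k P quarterDatum Finset.univ : Set (ToricChart.Ring k P quarterDatum)))) ∧
      IsIntegral (affineBlowup (faceIdeal k P quarterDatum {0, 1, 3} *
        (faceIdeal k P quarterDatum {0, 1, 3} ^ 2).colon
          (faceIdeal k P quarterDatum Finset.univ : Set (ToricChart.Ring k P quarterDatum)))) ∧
      IsProper (affineBlowup.π (faceIdeal k P quarterDatum {0, 1, 3} *
        (faceIdeal k P quarterDatum {0, 1, 3} ^ 2).colon
          (faceIdeal k P quarterDatum Finset.univ : Set (ToricChart.Ring k P quarterDatum)))) ∧
      IsBirational (affineBlowup.π (faceIdeal k P quarterDatum {0, 1, 3} *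
        (faceIdeal k P quarterDatum {0, 1, 3} ^ 2).colon
          (faceIdeal k P quarterDatum Finset.univ : Set (ToricChart.Ring k P quarterDatum)))) := by
  rw [faceIdeal_mul_colon_eq]
  exact blowup_regular k P

end FaceIdeals

end Summit.ResolutionOfSingularities.ResolutionOfSingularities.Theorems.WildQuotientResolution.Quarter1123

end
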